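import Summits.BirchSwinnertonDyer.BirchSwinnertonDyer.Theorems.Rank1ResidualIntModelReduction
import Summits.BirchSwinnertonDyer.Rank1Residual.X9.PrintCertBridge
import HarnessLib

/-!
# Route `ErratumRoadFive`, crux `EulerHalfNotRamNoInertSetAtFive` (item stmt-BirchSwinnertonDyer-19715), line `birth` (v10):
# the kernel rung **(19170s1, 5) ON THE SPLIT-SET ROAD THROUGH PASTEN'S `q = 2` CLAUSE** — the first of the five census pairs
# that the `q = 2` relaxation of the Papikian–Rabinoff half adds to the road (v10 card: 64 → 69 of 70), with the kernel proof that
# the pair carries NO split-set datum with the strict half `q ≠ 2` (v9 road) and DOES carry one with the relaxed half (v10 road)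

Cell `bsd-stepL`, seat `bsd-line-er5-p1-w4` (D-0154 width seat -w4 on crux 19715, lead `bsd-line-er5-p1`), `--supports stmt-BirchSwinnertonDyer-19715`.
THEOREMS ONLY, ONE curve: `E = [1,−1,1,−105383,13215711]` = Cremona 19170s1 (`N = 19170 = 2·3³·5·71`, `Δ_min = −2¹⁰·3³·5·71⁵`,
`c₄ = 3⁴·197·317`): multiplicative at `2` (split, `ord₂Δ_min = 10`), at `5` (non-split, `ord₅Δ_min = 1`) and at `71` (split,
`ord₇₁Δ_min = 5`, `71 ≡ 1 (mod 5)`); additive at `3`. At `p = 5` the pair is ¬(ram)-shaped (`5 ∣ 10`, `5 ∣ 5`), BOTH multiplicative primes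
`≠ 5` are OFFENDING split carriers, so every split-set datum `S ∌ 5` must contain `{2, 71}`, hence `S = {2, 71}`; there is no (W2)-witness
(`ord₂ = 10`, `ord₇₁ = 5`) and the only halves are `R = {2}` or `R = {71}`, `71 ≡ 1 (mod 5)`: the pair has NO datum with the strict half
`q ≠ 2 ∧ ¬ p ∣ q − 1` (`no_strictHalf_splitSetDatum`) and EXACTLY the datum `S = {2, 71}`, `R = {2}` with the relaxed half `¬ p ∣ q − 1`
(`splitSetDatum`; Pasten–Shimura L6.18: the cokernel order `j₂` divides `2`, so `q = 2` is a good pairing prime at odd `p`). Hence the line's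
DERIVED road `EulerHalfSplitTwinRoad.stub_splitSetRoadAtFive` (-w2 g0, p611250; relaxed half) serves the pair, modulo the route items
`PublishedInputsFive`, `X11aLowerHalf`, `ShimuraParametrizationDataNonempty`, `PastenComponentOrdersInput`, `ShimuraCasselsTateLevelInputs` and the
HELD `shimuraCurve_heegnerSystem_primitivesSplitReduced`, BY NAME (sibling file; here: the pair's LOCAL CERTIFICATE in the kernel).

* `Δ_eq` … `eq_of_mult` — integer-model facts of 19170s1 (pattern of -w2 g0 p613003 ∕ tam3-p2 g4; `IntModel.*` of `Rank1ResidualIntModelReduction`,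
  additive-is-not-multiplicative from `X9.PrintCert.not_hasMultiplicativeReductionAtPrime_of_dvd_of_dvd`).
* GENERIC (any `W`, any odd `p`): `splitSetDatum_pairTwo` (relaxed-half datum `S = {2, q}`, `R = {2}`) and
  `no_strictHalf_splitSetDatum_of_twoOffending` (two offending split carriers `2`, `q ≡ 1 (mod p)` and no other multiplicative prime `≠ p`
  ⟹ NO strict-half datum) — the shape shared by all five `q = 2` census pairs (19170s1, 167310f1, 410130dv1∕en1∕fc1 at `p = 5`).
* `not_five_dvd_padicValInt_of_split_of_not_mem`, `splitSetDatum` — the relaxed-half datum `S = {2, 71}`, `R = {2}` of (19170s1, 5).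
* `no_strictHalf_splitSetDatum` — NO datum with the strict half at (19170s1, 5): the `q = 2` clause is load-bearing at this pair.
* The RUNG itself (crux 19715's text at the pair from the route items, one line over the road) lives in the sibling cone file
  `…EulerHalfNotRamRungsSplitSetTwoOfItems.lean`; THIS file is route-independent (no `Theses` import: integer-model facts + bookkeeping only).

HONEST FRAMING: CONDITIONAL on the items (OPEN: `X11aLowerHalf`; typed-not-proved: `casselsTate_levelInputs`, the HELD split primitives,
`PastenShimura2024_componentOrders`, `nonempty_shimuraParametrizationData`); no definition, no named fact, no `sorry`; a helper, not a closure of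
crux 19715; BSD(19170s1, 5) is NOT proved by this; nothing booked; no summit statement is touched. References: [Cremona1997] Table 1 (19170s1);
[SilvermanAEC2009] VII.5 Prop. 5.1(b),(c); [PastenShimura2024] §6.4, Lemma 6.18; [PapikianRabinoff2016] Cor. 3.5; [JetchevSkinnerWan2017] §7.4.2.
-/

noncomputable section

open scoped Classical

open WeierstrassCurve NumberField IsDedekindDomain Rat.HeightOneSpectrum Literature.NumberTheory.EllipticCurves
  Literature.NumberTheory.EllipticCurves.Rank1Residual Summit.BirchSwinnertonDyer.BirchSwinnertonDyer.Rank1Residual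

set_option linter.dupNamespace false -- the cell's Theorems namespace repeats the summit name, as in every sibling file

namespace Summit.BirchSwinnertonDyer.BirchSwinnertonDyer.Theorems.EulerHalfSplitTwinRoad.Rung19170s1

/-! ### Integer-model facts of 19170s1 -/

/-- `Δ(E₀) = −249416665482240 = −2¹⁰·3³·5·71⁵` on the integer equation. [cite: Cremona1997, Table 1 (curve 19170s1)] -/
theorem Δ_eq : (⟨1, -1, 1, -105383, 13215711⟩ : WeierstrassCurve ℤ).Δ = -249416665482240 := by
  norm_num [WeierstrassCurve.Δ, WeierstrassCurve.b₂, WeierstrassCurve.b₄, WeierstrassCurve.b₆, WeierstrassCurve.b₈]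

/-- `c₄(E₀) = 5058369 = 3⁴·197·317` on the integer equation. [cite: Cremona1997, Table 1 (curve 19170s1)] -/
theorem c₄_eq : (⟨1, -1, 1, -105383, 13215711⟩ : WeierstrassCurve ℤ).c₄ = 5058369 := by
  norm_num [WeierstrassCurve.c₄, WeierstrassCurve.b₂, WeierstrassCurve.b₄]

/-- The tree's integral model of `E` is the integer equation itself. [folklore] -/
theorem integralModelInt_eq [((⟨1, -1, 1, -105383, 13215711⟩ : WeierstrassCurve ℤ).baseChange ℚ).IsGloballyMinimal] :
    integralModelInt ((⟨1, -1, 1, -105383, 13215711⟩ : WeierstrassCurve ℤ).baseChange ℚ) =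
      (⟨1, -1, 1, -105383, 13215711⟩ : WeierstrassCurve ℤ) :=
  IntModel.integralModelInt_eq_of_map_eq _ (by
    rw [WeierstrassCurve.baseChange, show algebraMap ℤ ℚ = Int.castRingHom ℚ from rfl])

/-- `Δ_min(E) = −249416665482240`. [cite: Cremona1997, Table 1 (curve 19170s1)] -/
theorem minimalDiscriminantInt_eq [((⟨1, -1, 1, -105383, 13215711⟩ : WeierstrassCurve ℤ).baseChange ℚ).IsGloballyMinimal] :
    ((⟨1, -1, 1, -105383, 13215711⟩ : WeierstrassCurve ℤ).baseChange ℚ).minimalDiscriminantInt = -249416665482240 := by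
  rw [IntModel.minimalDiscriminantInt_eq integralModelInt_eq, Δ_eq]

/-- **`E` is multiplicative at `2`** (`2 ∣ Δ`, `2 ∤ c₄`; Silverman AEC VII.5.1(b)). [cite: SilvermanAEC2009, VII.5 Prop. 5.1(b)] -/
theorem mult_two [Fact (Nat.Prime 2)] [((⟨1, -1, 1, -105383, 13215711⟩ : WeierstrassCurve ℤ).baseChange ℚ).IsElliptic]
    [((⟨1, -1, 1, -105383, 13215711⟩ : WeierstrassCurve ℤ).baseChange ℚ).IsGloballyMinimal] :
    Mult ((⟨1, -1, 1, -105383, 13215711⟩ : WeierstrassCurve ℤ).baseChange ℚ) 2 :=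
  IntModel.hasMultiplicativeReductionAtPrime_of_intModel integralModelInt_eq 2
    (by rw [Δ_eq]; norm_num) (by rw [c₄_eq]; norm_num)

/-- **`E` is multiplicative at `71`** (`71 ∣ Δ`, `71 ∤ c₄`). [cite: SilvermanAEC2009, VII.5 Prop. 5.1(b)] -/
theorem mult_seventyOne [Fact (Nat.Prime 71)] [((⟨1, -1, 1, -105383, 13215711⟩ : WeierstrassCurve ℤ).baseChange ℚ).IsElliptic]
    [((⟨1, -1, 1, -105383, 13215711⟩ : WeierstrassCurve ℤ).baseChange ℚ).IsGloballyMinimal] :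
    Mult ((⟨1, -1, 1, -105383, 13215711⟩ : WeierstrassCurve ℤ).baseChange ℚ) 71 :=
  IntModel.hasMultiplicativeReductionAtPrime_of_intModel integralModelInt_eq 71
    (by rw [Δ_eq]; norm_num) (by rw [c₄_eq]; norm_num)

/-- The node-tangent quadratic `c₄t² + a₁c₄t − (54b₆ − 3b₂b₄ + a₂c₄)` of the integer equation has the root `t = 0` modulo `2`.
[cite: SilvermanAEC2009, VII.5 Prop. 5.1(b)] -/
theorem nodal_root_two :
    ∃ t : ZMod 2, ((⟨1, -1, 1, -105383, 13215711⟩ : WeierstrassCurve ℤ).c₄ : ZMod 2) * t ^ 2 +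
      ((⟨1, -1, 1, -105383, 13215711⟩ : WeierstrassCurve ℤ).a₁ * (⟨1, -1, 1, -105383, 13215711⟩ : WeierstrassCurve ℤ).c₄ : ZMod 2) * t -
        (54 * (⟨1, -1, 1, -105383, 13215711⟩ : WeierstrassCurve ℤ).b₆ - 3 * (⟨1, -1, 1, -105383, 13215711⟩ : WeierstrassCurve ℤ).b₂ *
          (⟨1, -1, 1, -105383, 13215711⟩ : WeierstrassCurve ℤ).b₄ + (⟨1, -1, 1, -105383, 13215711⟩ : WeierstrassCurve ℤ).a₂ *
          (⟨1, -1, 1, -105383, 13215711⟩ : WeierstrassCurve ℤ).c₄ : ZMod 2) = 0 :=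
  ⟨0, by simp only [WeierstrassCurve.c₄, WeierstrassCurve.b₂, WeierstrassCurve.b₄, WeierstrassCurve.b₆]; decide⟩

/-- The node-tangent quadratic of the integer equation has the root `t = 18` modulo `71`. [cite: SilvermanAEC2009, VII.5 Prop. 5.1(b)] -/
theorem nodal_root_seventyOne :
    ∃ t : ZMod 71, ((⟨1, -1, 1, -105383, 13215711⟩ : WeierstrassCurve ℤ).c₄ : ZMod 71) * t ^ 2 +
      ((⟨1, -1, 1, -105383, 13215711⟩ : WeierstrassCurve ℤ).a₁ * (⟨1, -1, 1, -105383, 13215711⟩ : WeierstrassCurve ℤ).c₄ : ZMod 71) * t -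
        (54 * (⟨1, -1, 1, -105383, 13215711⟩ : WeierstrassCurve ℤ).b₆ - 3 * (⟨1, -1, 1, -105383, 13215711⟩ : WeierstrassCurve ℤ).b₂ *
          (⟨1, -1, 1, -105383, 13215711⟩ : WeierstrassCurve ℤ).b₄ + (⟨1, -1, 1, -105383, 13215711⟩ : WeierstrassCurve ℤ).a₂ *
          (⟨1, -1, 1, -105383, 13215711⟩ : WeierstrassCurve ℤ).c₄ : ZMod 71) = 0 :=
  ⟨18, by simp only [WeierstrassCurve.c₄, WeierstrassCurve.b₂, WeierstrassCurve.b₄, WeierstrassCurve.b₆]; decide⟩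

/-- **`E` is SPLIT multiplicative at `2`**: the node-tangent quadratic has a root modulo `2` (`nodal_root_two`).
[cite: SilvermanAEC2009, VII.5 Prop. 5.1(b)] [cite: Cremona1997, Table 1 (curve 19170s1)] -/
theorem split_two [Fact (Nat.Prime 2)] [((⟨1, -1, 1, -105383, 13215711⟩ : WeierstrassCurve ℤ).baseChange ℚ).IsElliptic]
    [((⟨1, -1, 1, -105383, 13215711⟩ : WeierstrassCurve ℤ).baseChange ℚ).IsGloballyMinimal] :
    ((⟨1, -1, 1, -105383, 13215711⟩ : WeierstrassCurve ℤ).baseChange ℚ).HasSplitMultiplicativeReductionAtPrime 2 :=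
  IntModel.hasSplitMultiplicativeReductionAtPrime_of_intModel_of_root integralModelInt_eq 2
    (by rw [Δ_eq]; norm_num) (by rw [c₄_eq]; norm_num) nodal_root_two

/-- **`E` is SPLIT multiplicative at `71`**: the node-tangent quadratic has a root modulo `71` (`nodal_root_seventyOne`).
[cite: SilvermanAEC2009, VII.5 Prop. 5.1(b)] [cite: Cremona1997, Table 1 (curve 19170s1)] -/
theorem split_seventyOne [Fact (Nat.Prime 71)] [((⟨1, -1, 1, -105383, 13215711⟩ : WeierstrassCurve ℤ).baseChange ℚ).IsElliptic]
    [((⟨1, -1, 1, -105383, 13215711⟩ : WeierstrassCurve ℤ).baseChange ℚ).IsGloballyMinimal] :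
    ((⟨1, -1, 1, -105383, 13215711⟩ : WeierstrassCurve ℤ).baseChange ℚ).HasSplitMultiplicativeReductionAtPrime 71 :=
  IntModel.hasSplitMultiplicativeReductionAtPrime_of_intModel_of_root integralModelInt_eq 71
    (by rw [Δ_eq]; norm_num) (by rw [c₄_eq]; norm_num) nodal_root_seventyOne

/-- **`E` is NOT multiplicative at `3`** (`3 ∣ Δ`, `3 ∣ c₄`: additive). [cite: SilvermanAEC2009, VII.5 Prop. 5.1(c)] [cite: Cremona1997, Table 1 (curve 19170s1)] -/
theorem not_mult_three [Fact (Nat.Prime 3)] [((⟨1, -1, 1, -105383, 13215711⟩ : WeierstrassCurve ℤ).baseChange ℚ).IsElliptic]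
    [((⟨1, -1, 1, -105383, 13215711⟩ : WeierstrassCurve ℤ).baseChange ℚ).IsGloballyMinimal] :
    ¬ ((⟨1, -1, 1, -105383, 13215711⟩ : WeierstrassCurve ℤ).baseChange ℚ).HasMultiplicativeReductionAtPrime 3 :=
  Summit.BirchSwinnertonDyer.Rank1Residual.X9.PrintCert.not_hasMultiplicativeReductionAtPrime_of_dvd_of_dvd integralModelInt_eq 3
    (by rw [Δ_eq]; norm_num) (by rw [c₄_eq]; norm_num)

/-- `ord₂Δ_min(E) = 10`. [cite: Cremona1997, Table 1 (curve 19170s1)] -/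
theorem padicValInt_two_eq [Fact (Nat.Prime 2)] [((⟨1, -1, 1, -105383, 13215711⟩ : WeierstrassCurve ℤ).baseChange ℚ).IsGloballyMinimal] :
    padicValInt 2 ((⟨1, -1, 1, -105383, 13215711⟩ : WeierstrassCurve ℤ).baseChange ℚ).minimalDiscriminantInt = 10 := by
  rw [minimalDiscriminantInt_eq]
  exact IntModel.padicValInt_eq_of_dvd_of_not_dvd 2 (e := 10) (by norm_num) (by norm_num)

/-- `ord₅Δ_min(E) = 1`. [cite: Cremona1997, Table 1 (curve 19170s1)] -/
theorem padicValInt_five_eq [Fact (Nat.Prime 5)] [((⟨1, -1, 1, -105383, 13215711⟩ : WeierstrassCurve ℤ).baseChange ℚ).IsGloballyMinimal] :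
    padicValInt 5 ((⟨1, -1, 1, -105383, 13215711⟩ : WeierstrassCurve ℤ).baseChange ℚ).minimalDiscriminantInt = 1 := by
  rw [minimalDiscriminantInt_eq]
  exact IntModel.padicValInt_eq_of_dvd_of_not_dvd 5 (e := 1) (by norm_num) (by norm_num)

/-- `ord₇₁Δ_min(E) = 5`. [cite: Cremona1997, Table 1 (curve 19170s1)] -/
theorem padicValInt_seventyOne_eq [Fact (Nat.Prime 71)] [((⟨1, -1, 1, -105383, 13215711⟩ : WeierstrassCurve ℤ).baseChange ℚ).IsGloballyMinimal] :
    padicValInt 71 ((⟨1, -1, 1, -105383, 13215711⟩ : WeierstrassCurve ℤ).baseChange ℚ).minimalDiscriminantInt = 5 := by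
  rw [minimalDiscriminantInt_eq]
  exact IntModel.padicValInt_eq_of_dvd_of_not_dvd 71 (e := 5) (by norm_num) (by norm_num)

/-- A prime dividing `Δ_min(E) = −2¹⁰·3³·5·71⁵` is one of `2, 3, 5, 71`. [cite: Cremona1997, Table 1 (curve 19170s1)] -/
theorem eq_of_prime_dvd_Δ {ℓ : ℕ} (hℓ : ℓ.Prime) (h : (ℓ : ℤ) ∣ -249416665482240) :
    ℓ = 2 ∨ ℓ = 3 ∨ ℓ = 5 ∨ ℓ = 71 := by
  have h' : ℓ ∣ 2 ^ 10 * 3 ^ 3 * 5 * 71 ^ 5 := by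
    have h1 : (ℓ : ℤ) ∣ ((249416665482240 : ℕ) : ℤ) := by
      rw [← dvd_neg]; exact_mod_cast h
    have h2 : ℓ ∣ 249416665482240 := Int.natCast_dvd_natCast.mp h1
    norm_num
    exact h2
  rcases (Nat.Prime.dvd_mul hℓ).mp h' with h1 | h1
  · rcases (Nat.Prime.dvd_mul hℓ).mp h1 with h2 | h2
    · rcases (Nat.Prime.dvd_mul hℓ).mp h2 with h3 | h3
      · exact Or.inl ((Nat.prime_dvd_prime_iff_eq hℓ Nat.prime_two).mp (hℓ.dvd_of_dvd_pow h3))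
      · exact Or.inr (Or.inl ((Nat.prime_dvd_prime_iff_eq hℓ Nat.prime_three).mp (hℓ.dvd_of_dvd_pow h3)))
    · exact Or.inr (Or.inr (Or.inl ((Nat.prime_dvd_prime_iff_eq hℓ Nat.prime_five).mp h2)))
  · exact Or.inr (Or.inr (Or.inr ((Nat.prime_dvd_prime_iff_eq hℓ (by norm_num)).mp (hℓ.dvd_of_dvd_pow h1))))

/-! ### Generic: the «two offending split carriers `2` and `q`» shape at an odd `p` -/

section Generic

variable {W : WeierstrassCurve ℚ} [W.IsGloballyMinimal]

/-- **A relaxed-half split-set datum `S = {2, q}`, `R = {2}` at an odd `p`** from: `2` and `q` multiplicative (`q ≠ 2`, `q ≠ p`) and no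
offending split prime off `{2, q}`. The half `R = {2}` satisfies `¬ p ∣ 2 − 1` for every prime `p` — this is Pasten–Shimura's L6.18
(`j₂ ∣ 2`: `2` is a good pairing prime at odd `p`) as used by the line's v10 road. Pure bookkeeping. [cite: PastenShimura2024, Lemma 6.18]
[cite: PapikianRabinoff2016, Cor. 3.5] -/
theorem splitSetDatum_pairTwo (p q : ℕ) [hp : Fact p.Prime] [hq : Fact q.Prime] (hp2 : p ≠ 2) (hq2 : q ≠ 2) (hqp : q ≠ p)
    (hm2 : W.HasMultiplicativeReductionAtPrime 2) (hmq : W.HasMultiplicativeReductionAtPrime q)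
    (hFC : ∀ (ℓ : ℕ) [Fact ℓ.Prime], ℓ ∉ ({2, q} : Finset ℕ) → W.HasSplitMultiplicativeReductionAtPrime ℓ →
      ¬ p ∣ padicValInt ℓ W.minimalDiscriminantInt) :
    ∃ S : Finset ℕ, (∀ ℓ ∈ S, ∃ _ : Fact ℓ.Prime, Mult W ℓ) ∧ Even S.card ∧ p ∉ S ∧
      (∀ (ℓ : ℕ) [Fact ℓ.Prime], ℓ ∉ S → W.HasSplitMultiplicativeReductionAtPrime ℓ → ¬ p ∣ padicValInt ℓ W.minimalDiscriminantInt) ∧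
      ((∃ (ℓ₀ : ℕ) (_ : Fact ℓ₀.Prime), Mult W ℓ₀ ∧ ℓ₀ ≠ p ∧ ¬ p ∣ padicValInt ℓ₀ W.minimalDiscriminantInt) ∨
        ∃ R ⊆ S, S.card = 2 * R.card ∧ ∀ q ∈ R, ¬ p ∣ q - 1) := by
  haveI : Fact (Nat.Prime 2) := ⟨Nat.prime_two⟩
  refine ⟨{2, q}, ?_, ?_, ?_, hFC, Or.inr ⟨{2}, by simp, ?_, ?_⟩⟩
  · intro ℓ hℓ
    simp only [Finset.mem_insert, Finset.mem_singleton] at hℓ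
    rcases hℓ with rfl | rfl
    · exact ⟨⟨Nat.prime_two⟩, hm2⟩
    · exact ⟨hq, hmq⟩
  · rw [Finset.card_pair hq2.symm]
    exact even_two
  · simp only [Finset.mem_insert, Finset.mem_singleton, not_or]
    exact ⟨hp2, fun h ↦ hqp h.symm⟩
  · rw [Finset.card_pair hq2.symm, Finset.card_singleton]
  · intro r hr
    rw [Finset.mem_singleton] at hr
    subst hr
    rw [show (2 : ℕ) - 1 = 1 from rfl, Nat.dvd_one]
    exact hp.out.ne_one

/-- **NO split-set datum with the STRICT half `∀ r ∈ R, r ≠ 2 ∧ ¬ p ∣ r − 1`** (the v9 road's shape) when `2` and `q` are OFFENDING split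
carriers (`p ∣ ord₂Δ_min`, `p ∣ ord_qΔ_min`) with `p ∣ q − 1` and every multiplicative prime is one of `2, p, q`: a datum `S ∌ p` contains both
offenders, hence `S = {2, q}`; no (W2)-witness exists and a size-one half avoiding `2` is `{q}`, `q ≡ 1 (mod p)`. So at such pairs the `q = 2`
clause of the relaxed half is LOAD-BEARING. Pure bookkeeping. [cite: PastenShimura2024, Lemma 6.18] [cite: PapikianRabinoff2016, Cor. 3.5] -/
theorem no_strictHalf_splitSetDatum_of_twoOffending (p q : ℕ) [hp : Fact p.Prime] [hq : Fact q.Prime]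
    (h2s : W.HasSplitMultiplicativeReductionAtPrime 2) (h2v : p ∣ padicValInt 2 W.minimalDiscriminantInt)
    (hqs : W.HasSplitMultiplicativeReductionAtPrime q) (hqv : p ∣ padicValInt q W.minimalDiscriminantInt) (hq1 : p ∣ q - 1)
    (hmult : ∀ (ℓ : ℕ) [Fact ℓ.Prime], W.HasMultiplicativeReductionAtPrime ℓ → ℓ = 2 ∨ ℓ = p ∨ ℓ = q) :
    ¬ ∃ S : Finset ℕ, (∀ ℓ ∈ S, ∃ _ : Fact ℓ.Prime, Mult W ℓ) ∧ Even S.card ∧ p ∉ S ∧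
      (∀ (ℓ : ℕ) [Fact ℓ.Prime], ℓ ∉ S → W.HasSplitMultiplicativeReductionAtPrime ℓ → ¬ p ∣ padicValInt ℓ W.minimalDiscriminantInt) ∧
      ((∃ (ℓ₀ : ℕ) (_ : Fact ℓ₀.Prime), Mult W ℓ₀ ∧ ℓ₀ ≠ p ∧ ¬ p ∣ padicValInt ℓ₀ W.minimalDiscriminantInt) ∨
        ∃ R ⊆ S, S.card = 2 * R.card ∧ ∀ r ∈ R, r ≠ 2 ∧ ¬ p ∣ r - 1) := by
  haveI : Fact (Nat.Prime 2) := ⟨Nat.prime_two⟩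
  rintro ⟨S, hSm, -, hpS, hFC, hdeg⟩
  -- both offending carriers lie in `S`
  have h2S : 2 ∈ S := by
    by_contra h
    exact hFC 2 h h2s h2v
  have hqS : q ∈ S := by
    by_contra h
    exact hFC q h hqs hqv
  -- `S = {2, q}`
  have hSsub : S ⊆ {2, q} := by
    intro ℓ hℓ
    obtain ⟨hℓF, hm⟩ := hSm ℓ hℓ
    rcases hmult ℓ hm with rfl | rfl | rfl
    · simp
    · exact absurd hℓ hpS
    · simp
  have hSeq : S = {2, q} := Finset.Subset.antisymm hSsub (by
    intro ℓ hℓ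
    simp only [Finset.mem_insert, Finset.mem_singleton] at hℓ
    rcases hℓ with rfl | rfl
    · exact h2S
    · exact hqS)
  subst hSeq
  rcases hdeg with ⟨ℓ₀, hℓ₀F, hm₀, h₀p, h₀v⟩ | ⟨R, hRS, hcard, hR⟩
  · rcases hmult ℓ₀ hm₀ with rfl | rfl | rfl
    · exact h₀v h2v
    · exact h₀p rfl
    · exact h₀v hqv
  · -- `q ≠ 2` (as `p ∣ q − 1` and `p ≠ 1`), so `#R = 1`; `R ⊆ {2, q}` avoiding `2` is `{q}`, but `p ∣ q − 1`
    have hq2 : q ≠ 2 := by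
      rintro rfl
      rw [show (2 : ℕ) - 1 = 1 from rfl, Nat.dvd_one] at hq1
      exact hp.out.ne_one hq1
    have hcard1 : R.card = 1 := by
      rw [Finset.card_pair hq2.symm] at hcard
      omega
    obtain ⟨r, hRr⟩ := Finset.card_eq_one.mp hcard1
    subst hRr
    have hr : r ∈ ({2, q} : Finset ℕ) := hRS (Finset.mem_singleton_self r)
    obtain ⟨hr2, hrp⟩ := hR r (Finset.mem_singleton_self r)
    simp only [Finset.mem_insert, Finset.mem_singleton] at hr
    rcases hr with rfl | rfl
    · exact hr2 rfl
    · exact hrp hq1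

end Generic

/-! ### The split-set datum of (19170s1, 5) with the relaxed half, and the absence of one with the strict half -/

/-- **The multiplicative primes of `E` are among `2, 5, 71`**: a multiplicative prime divides `Δ_min = −2¹⁰·3³·5·71⁵`, and `3` is additive.
[cite: Cremona1997, Table 1 (curve 19170s1)] [cite: SilvermanAEC2009, VII.5 Prop. 5.1(b),(c)] -/
theorem eq_of_mult [((⟨1, -1, 1, -105383, 13215711⟩ : WeierstrassCurve ℤ).baseChange ℚ).IsElliptic]
    [((⟨1, -1, 1, -105383, 13215711⟩ : WeierstrassCurve ℤ).baseChange ℚ).IsGloballyMinimal] :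
    ∀ (ℓ : ℕ) [Fact ℓ.Prime], ((⟨1, -1, 1, -105383, 13215711⟩ : WeierstrassCurve ℤ).baseChange ℚ).HasMultiplicativeReductionAtPrime ℓ →
      ℓ = 2 ∨ ℓ = 5 ∨ ℓ = 71 := by
  intro ℓ hℓF hm
  have hdvd : (ℓ : ℤ) ∣ ((⟨1, -1, 1, -105383, 13215711⟩ : WeierstrassCurve ℤ).baseChange ℚ).minimalDiscriminantInt := by
    by_contra h
    exact WeierstrassCurve.HasMultiplicativeReduction.not_hasGoodReduction (R := ℤ_[ℓ]) hm
      (WeierstrassCurve.hasGoodReductionAtPrime_of_not_dvd _ ℓ h)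
  rw [minimalDiscriminantInt_eq] at hdvd
  rcases eq_of_prime_dvd_Δ hℓF.out hdvd with h | rfl | h | h
  · exact Or.inl h
  · exact absurd hm not_mult_three
  · exact Or.inr (Or.inl h)
  · exact Or.inr (Or.inr h)

/-- **No offending split prime off `S = {2, 71}` at `p = 5`**: a split multiplicative `ℓ ∉ {2, 71}` of `E` is `5`, where `ord₅Δ_min = 1`
(`5` is in fact non-split; only the valuation is used). [cite: Cremona1997, Table 1 (curve 19170s1)] [cite: SilvermanAEC2009, VII.5 Prop. 5.1(b)] -/
theorem not_five_dvd_padicValInt_of_split_of_not_mem [Fact (Nat.Prime 5)]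
    [((⟨1, -1, 1, -105383, 13215711⟩ : WeierstrassCurve ℤ).baseChange ℚ).IsElliptic]
    [((⟨1, -1, 1, -105383, 13215711⟩ : WeierstrassCurve ℤ).baseChange ℚ).IsGloballyMinimal] :
    ∀ (ℓ : ℕ) [Fact ℓ.Prime], ℓ ∉ ({2, 71} : Finset ℕ) →
      ((⟨1, -1, 1, -105383, 13215711⟩ : WeierstrassCurve ℤ).baseChange ℚ).HasSplitMultiplicativeReductionAtPrime ℓ →
      ¬ 5 ∣ padicValInt ℓ ((⟨1, -1, 1, -105383, 13215711⟩ : WeierstrassCurve ℤ).baseChange ℚ).minimalDiscriminantInt := by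
  intro ℓ hℓF hℓS hs
  rcases eq_of_mult ℓ hs.hasMultiplicativeReductionAtPrime with rfl | rfl | rfl
  · simp at hℓS
  · rw [padicValInt_five_eq]
    decide
  · simp at hℓS

/-- **The split-set datum of (19170s1, 5): `S = {2, 71}`, `R = {2}`** (both `S`-primes multiplicative; `#S = 2`; `5 ∉ S`; no offending split
prime off `S`; Papikian–Rabinoff half `R = {2}` in the RELAXED form `¬ 5 ∣ 2 − 1` — Pasten–Shimura L6.18: `j₂ ∣ 2` makes `2` a good pairing prime
at odd `p`), in the shape of the line's road `stub_splitSetRoadAtFive`. [cite: PastenShimura2024, Lemma 6.18] [cite: PapikianRabinoff2016, Cor. 3.5]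
[cite: Cremona1997, Table 1 (curve 19170s1)] -/
theorem splitSetDatum [Fact (Nat.Prime 5)]
    [((⟨1, -1, 1, -105383, 13215711⟩ : WeierstrassCurve ℤ).baseChange ℚ).IsElliptic]
    [((⟨1, -1, 1, -105383, 13215711⟩ : WeierstrassCurve ℤ).baseChange ℚ).IsGloballyMinimal] :
    ∃ S : Finset ℕ, (∀ ℓ ∈ S, ∃ _ : Fact ℓ.Prime, Mult ((⟨1, -1, 1, -105383, 13215711⟩ : WeierstrassCurve ℤ).baseChange ℚ) ℓ) ∧
      Even S.card ∧ 5 ∉ S ∧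
      (∀ (ℓ : ℕ) [Fact ℓ.Prime], ℓ ∉ S →
        ((⟨1, -1, 1, -105383, 13215711⟩ : WeierstrassCurve ℤ).baseChange ℚ).HasSplitMultiplicativeReductionAtPrime ℓ →
        ¬ 5 ∣ padicValInt ℓ ((⟨1, -1, 1, -105383, 13215711⟩ : WeierstrassCurve ℤ).baseChange ℚ).minimalDiscriminantInt) ∧
      ((∃ (ℓ₀ : ℕ) (_ : Fact ℓ₀.Prime), Mult ((⟨1, -1, 1, -105383, 13215711⟩ : WeierstrassCurve ℤ).baseChange ℚ) ℓ₀ ∧ ℓ₀ ≠ 5 ∧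
          ¬ 5 ∣ padicValInt ℓ₀ ((⟨1, -1, 1, -105383, 13215711⟩ : WeierstrassCurve ℤ).baseChange ℚ).minimalDiscriminantInt) ∨
        ∃ R ⊆ S, S.card = 2 * R.card ∧ ∀ q ∈ R, ¬ 5 ∣ q - 1) :=
  haveI : Fact (Nat.Prime 2) := ⟨Nat.prime_two⟩
  haveI : Fact (Nat.Prime 71) := ⟨by norm_num⟩
  splitSetDatum_pairTwo 5 71 (by decide) (by decide) (by decide) mult_two mult_seventyOne
    not_five_dvd_padicValInt_of_split_of_not_mem

/-- **NO split-set datum with the STRICT half at (19170s1, 5)** (the v9 road's shape `∀ q ∈ R, q ≠ 2 ∧ ¬ p ∣ q − 1`): both multiplicative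
primes `≠ 5`, namely `2` and `71`, are offending split carriers (`ord = 10, 5`) and `71 ≡ 1 (mod 5)`
(`no_strictHalf_splitSetDatum_of_twoOffending`). Hence the `q = 2` clause of the relaxed half is LOAD-BEARING at this pair — it is served by the
v10 road and NOT by the v9 road. [cite: Cremona1997, Table 1 (curve 19170s1)] [cite: PastenShimura2024, Lemma 6.18] [cite: PapikianRabinoff2016, Cor. 3.5] -/
theorem no_strictHalf_splitSetDatum [Fact (Nat.Prime 5)]
    [((⟨1, -1, 1, -105383, 13215711⟩ : WeierstrassCurve ℤ).baseChange ℚ).IsElliptic]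
    [((⟨1, -1, 1, -105383, 13215711⟩ : WeierstrassCurve ℤ).baseChange ℚ).IsGloballyMinimal] :
    ¬ ∃ S : Finset ℕ, (∀ ℓ ∈ S, ∃ _ : Fact ℓ.Prime, Mult ((⟨1, -1, 1, -105383, 13215711⟩ : WeierstrassCurve ℤ).baseChange ℚ) ℓ) ∧
      Even S.card ∧ 5 ∉ S ∧
      (∀ (ℓ : ℕ) [Fact ℓ.Prime], ℓ ∉ S →
        ((⟨1, -1, 1, -105383, 13215711⟩ : WeierstrassCurve ℤ).baseChange ℚ).HasSplitMultiplicativeReductionAtPrime ℓ →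
        ¬ 5 ∣ padicValInt ℓ ((⟨1, -1, 1, -105383, 13215711⟩ : WeierstrassCurve ℤ).baseChange ℚ).minimalDiscriminantInt) ∧
      ((∃ (ℓ₀ : ℕ) (_ : Fact ℓ₀.Prime), Mult ((⟨1, -1, 1, -105383, 13215711⟩ : WeierstrassCurve ℤ).baseChange ℚ) ℓ₀ ∧ ℓ₀ ≠ 5 ∧
          ¬ 5 ∣ padicValInt ℓ₀ ((⟨1, -1, 1, -105383, 13215711⟩ : WeierstrassCurve ℤ).baseChange ℚ).minimalDiscriminantInt) ∨
        ∃ R ⊆ S, S.card = 2 * R.card ∧ ∀ q ∈ R, q ≠ 2 ∧ ¬ 5 ∣ q - 1) :=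
  haveI : Fact (Nat.Prime 2) := ⟨Nat.prime_two⟩
  haveI : Fact (Nat.Prime 71) := ⟨by norm_num⟩
  no_strictHalf_splitSetDatum_of_twoOffending 5 71 split_two (by rw [padicValInt_two_eq]; decide) split_seventyOne
    (by rw [padicValInt_seventyOne_eq]) (by decide) eq_of_mult

end Summit.BirchSwinnertonDyer.BirchSwinnertonDyer.Theorems.EulerHalfSplitTwinRoad.Rung19170s1

end
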